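/-
HONEST FRAMING: certified error envelopes and provably optimal rounding/accumulation schemes for
low-precision formats under stated cost models; every table by two implementations; no hardware
or vendor claims.
-/
import Summits.Ventures.CertifiedArithmetic.LowPrec.OptDemotionAllLines

/-!
# The demotion law (Theorem T8), part 6k: the LINE REGION of the full family (opt gen 12; placed by the lean seat gen 11)

OPTIMA.md §B T8(b)(iii″)(R11).  Two structural inequalities satisfied by EVERY line `(α, λ)` of the
full family `L_t = allLines u t` of every summation tree (`μ_t = treeM u t - 1`, `0 ≤ u ≤ 1`),
proved by one simultaneous induction over the four transforms `F1 … F4`: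

* (D, "slope ≤ deficit / u²")   `u² · λ ≤ μ_t - α`  — in particular the only lines through the top
  `α = μ_t` are flat (the μ-line `(μ_t, 0)`), so the envelope leaves `ρ = 0` with slope `0`;
* (K2, "slope–intercept trade-off")   `λ + u · α ≤ μ_t - u + u²` at every node (and `≤ 0` at a
  leaf) — tight on every chain `((LL)L)…L` (its steepest line `(u, μ_t - u)`), and the reason the
  "realised slope fraction" of the envelope never exceeds `1 - u`.

Consequences recorded here: `λ + u·α ≤ μ_t` for every tree (`allLines_K2'`), and the ENVELOPE BOUND
`treeQf u t ρ ≤ 1 + ρ + μ_t + ρ (μ_t - u)(1 - u)` for `0 < ρ ≤ 1/u` at every node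
(`treeQf_le_of_lineRegion`), sharpening `allLines_bounds` (`λ ≤ μ_t`, i.e. slope fraction 1).
Checked numerically by opt gen 12 on 626 111 lines of 16 036 trees at `q = 3,4,5` (0 exceptions; K2
tight exactly on chains, D tight up to the factor 0.84).  These are the first two facets of the
realisable line region; they are NOT yet sufficient for the node step of Conjecture D (see OPTIMA
T8(b)(iii″)(R11) for what is).
-/

namespace Summit.Ventures.CertifiedArithmetic.LowPrec.Opt

open Literature.ComputerArithmetic.JeannerodRump2018
open Literature.ComputerArithmetic.JeannerodRump2018.SumTree

/-- THE LINE REGION (simultaneous induction): every line `(α, λ) ∈ L_t` has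
`u²λ ≤ μ_t - α` (D) and `λ + uα ≤ max (μ_t - u + u²) 0` (K2; the `max` only matters at a leaf). -/
theorem allLines_region {u : ℚ} (hu0 : 0 ≤ u) (hu1 : u ≤ 1) :
    ∀ (t : SumTree) (l : ℚ × ℚ), l ∈ allLines u t →
      u * u * l.2 ≤ (treeM u t - 1) - l.1 ∧
      l.2 + u * l.1 ≤ max ((treeM u t - 1) - u + u * u) 0
  | .leaf x, l, h => by
      simp only [allLines_leaf, List.mem_singleton] at h
      subst h
      refine ⟨by simp, ?_⟩
      simp only [mul_zero, add_zero]
      exact le_max_right _ _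
  | .node a b, l, h => by
      have hMa := one_le_treeM hu0 a
      have hMb := one_le_treeM hu0 b
      have hN := treeM_node_sub_one_ge hu0 hu1 a b
      have hu2 : u * u ≤ u := by nlinarith
      have hub : 0 ≤ u * (treeM u b - 1) := mul_nonneg hu0 (by linarith)
      have hua : 0 ≤ u * (treeM u a - 1) := mul_nonneg hu0 (by linarith)
      have hμs : u ≤ treeM u (.node a b) - 1 := by linarith [hN.1]
      have hmax : max ((treeM u (.node a b) - 1) - u + u * u) 0
          = (treeM u (.node a b) - 1) - u + u * u :=
        max_eq_left (by nlinarith [mul_nonneg hu0 hu0])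
      rw [hmax]
      rcases mem_allLines_node h with ⟨m, hm, rfl⟩ | ⟨m, hm, rfl⟩ | ⟨m, hm, rfl⟩ | ⟨m, hm, rfl⟩
      · -- F1 : (α + u + u μ_b, λ) from a line (α, λ) of a
        obtain ⟨hD, hK⟩ := allLines_region hu0 hu1 a m hm
        obtain ⟨h0, h1, h2, h3⟩ := allLines_bounds hu0 hu1 a m hm
        have hKa : m.2 + u * m.1 ≤ treeM u a - 1 :=
          le_trans hK (max_le (by linarith) (by linarith))
        constructor
        · dsimp only; linarith [hN.1]
        · dsimp only
          have : u * u * (treeM u b - 1) ≤ u * (treeM u b - 1) :=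
            mul_le_mul_of_nonneg_right hu2 (by linarith)
          nlinarith [hN.1]
      · -- F2 : symmetric
        obtain ⟨hD, hK⟩ := allLines_region hu0 hu1 b m hm
        obtain ⟨h0, h1, h2, h3⟩ := allLines_bounds hu0 hu1 b m hm
        have hKb : m.2 + u * m.1 ≤ treeM u b - 1 :=
          le_trans hK (max_le (by linarith) (by linarith))
        constructor
        · dsimp only; linarith [hN.2]
        · dsimp only
          have : u * u * (treeM u a - 1) ≤ u * (treeM u a - 1) :=
            mul_le_mul_of_nonneg_right hu2 (by linarith)
          nlinarith [hN.2]
      · -- F3 : (u + μ_a + u λ, α) from a line (α, λ) of b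
        obtain ⟨hD, hK⟩ := allLines_region hu0 hu1 b m hm
        obtain ⟨h0, h1, h2, h3⟩ := allLines_bounds hu0 hu1 b m hm
        have hKb : m.2 + u * m.1 ≤ treeM u b - 1 :=
          le_trans hK (max_le (by linarith) (by linarith))
        constructor
        · dsimp only
          have key : u * (m.2 + u * m.1) ≤ u * (treeM u b - 1) := mul_le_mul_of_nonneg_left hKb hu0
          nlinarith [hN.1]
        · dsimp only; nlinarith [hN.2]
      · -- F4 : symmetric
        obtain ⟨hD, hK⟩ := allLines_region hu0 hu1 a m hm
        obtain ⟨h0, h1, h2, h3⟩ := allLines_bounds hu0 hu1 a m hm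
        have hKa : m.2 + u * m.1 ≤ treeM u a - 1 :=
          le_trans hK (max_le (by linarith) (by linarith))
        constructor
        · dsimp only
          have key : u * (m.2 + u * m.1) ≤ u * (treeM u a - 1) := mul_le_mul_of_nonneg_left hKa hu0
          nlinarith [hN.2]
        · dsimp only; nlinarith [hN.1]

/-- (D) SLOPE ≤ DEFICIT / u²: every line `(α, λ) ∈ L_t` has `u²·λ ≤ μ_t - α`; the lines through the
top (`α = μ_t`) are flat. -/
theorem allLines_slope_le_deficit {u : ℚ} (hu0 : 0 ≤ u) (hu1 : u ≤ 1) (t : SumTree) (l : ℚ × ℚ)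
    (h : l ∈ allLines u t) : u * u * l.2 ≤ (treeM u t - 1) - l.1 :=
  (allLines_region hu0 hu1 t l h).1

/-- (K2) SLOPE–INTERCEPT TRADE-OFF at a node: `λ + u·α ≤ μ_t - u + u²` for every line of `L_(a·b)`
(equality for the steepest line `(u, μ_t - u)` of a chain). -/
theorem allLines_K2 {u : ℚ} (hu0 : 0 ≤ u) (hu1 : u ≤ 1) (a b : SumTree) (l : ℚ × ℚ)
    (h : l ∈ allLines u (.node a b)) :
    l.2 + u * l.1 ≤ (treeM u (.node a b) - 1) - u + u * u := by
  have hN := treeM_node_sub_one_ge hu0 hu1 a b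
  have hMa := one_le_treeM hu0 a
  have hub : 0 ≤ u * (treeM u b - 1) := mul_nonneg hu0 (by linarith [one_le_treeM hu0 b])
  have hmax : max ((treeM u (.node a b) - 1) - u + u * u) 0
      = (treeM u (.node a b) - 1) - u + u * u :=
    max_eq_left (by nlinarith [mul_nonneg hu0 hu0, hN.1])
  have := (allLines_region hu0 hu1 (.node a b) l h).2
  rwa [hmax] at this

/-- (K2') for every tree: `λ + u·α ≤ μ_t`. -/
theorem allLines_K2' {u : ℚ} (hu0 : 0 ≤ u) (hu1 : u ≤ 1) (t : SumTree) (l : ℚ × ℚ)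
    (h : l ∈ allLines u t) : l.2 + u * l.1 ≤ treeM u t - 1 := by
  have h1 := one_le_treeM hu0 t
  have hu2 : u * u ≤ u := by nlinarith
  exact le_trans (allLines_region hu0 hu1 t l h).2 (max_le (by linarith) (by linarith))

/-- ENVELOPE BOUND from K2: at a node, for `0 < ρ` with `u ρ ≤ 1`,
`treeQf u (a·b) ρ ≤ 1 + ρ + μ + ρ (μ - u)(1 - u)` (`μ = M_(a·b) - 1`): the coupled polynomial grows
from `M_t` with slope at most `1 + (μ - u)(1 - u)`, not `1 + μ`. -/
theorem treeQf_le_of_lineRegion {u : ℚ} (hu : 0 < u) (hu1 : u ≤ 1) (a b : SumTree) {ρ : ℚ}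
    (hρ : 0 < ρ) (hρu : u * ρ ≤ 1) :
    treeQf u (.node a b) ρ ≤
      1 + ρ + (treeM u (.node a b) - 1) + ρ * ((treeM u (.node a b) - 1) - u) * (1 - u) := by
  obtain ⟨l, hl, he⟩ := exists_allLine_eq_treeQf hu (.node a b) ρ hρ
  have hK := allLines_K2 hu.le hu1 a b l hl
  obtain ⟨h0, h1, h2, h3⟩ := allLines_bounds hu.le hu1 (.node a b) l hl
  rw [← he]
  -- λ ≤ μ - u + u² - uα, so α + λρ ≤ α (1 - uρ) + ρ (μ - u + u²) ≤ μ (1 - uρ) + ρ (μ - u + u²)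
  have e1 : l.2 * ρ ≤ ((treeM u (.node a b) - 1) - u + u * u - u * l.1) * ρ :=
    mul_le_mul_of_nonneg_right (by linarith) hρ.le
  have e2 : l.1 * (1 - u * ρ) ≤ (treeM u (.node a b) - 1) * (1 - u * ρ) :=
    mul_le_mul_of_nonneg_right h3 (by linarith)
  nlinarith [e1, e2]

/-! ## Profile-level consequences (the PROVED CATALOGUE of opt gen 12)

Write `G_t(ρ) := treeQf u t ρ - 1 - ρ` (the envelope of `L_t`, `treeQf_eq_envelope`) and `μ := M_t - 1`.
The node-step certificates of OPTIMA T8(b)(iii″)(R11) use only the following linear facts about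
`G_t` at finitely many points; each is a short consequence of a per-line fact and the envelope
property (`0 < u ≤ 1`; NODE where stated).  -/

/-- Intercepts of the lines of a NODE are at least `u`. -/
theorem allLines_node_fst_ge {u : ℚ} (hu0 : 0 ≤ u) (hu1 : u ≤ 1) (a b : SumTree) (l : ℚ × ℚ)
    (h : l ∈ allLines u (.node a b)) : u ≤ l.1 := by
  have hMa := one_le_treeM hu0 a
  have hMb := one_le_treeM hu0 b
  rcases mem_allLines_node h with ⟨m, hm, rfl⟩ | ⟨m, hm, rfl⟩ | ⟨m, hm, rfl⟩ | ⟨m, hm, rfl⟩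
  · obtain ⟨-, -, h2, -⟩ := allLines_bounds hu0 hu1 a m hm
    dsimp only; nlinarith [mul_nonneg hu0 (by linarith : (0:ℚ) ≤ treeM u b - 1)]
  · obtain ⟨-, -, h2, -⟩ := allLines_bounds hu0 hu1 b m hm
    dsimp only; nlinarith [mul_nonneg hu0 (by linarith : (0:ℚ) ≤ treeM u a - 1)]
  · obtain ⟨h0, -, -, -⟩ := allLines_bounds hu0 hu1 b m hm
    dsimp only; nlinarith [mul_nonneg hu0 h0]
  · obtain ⟨h0, -, -, -⟩ := allLines_bounds hu0 hu1 a m hm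
    dsimp only; nlinarith [mul_nonneg hu0 h0]

/-- Slopes of the lines of a NODE are at most `μ - u`. -/
theorem allLines_node_snd_le {u : ℚ} (hu0 : 0 ≤ u) (hu1 : u ≤ 1) (a b : SumTree) (l : ℚ × ℚ)
    (h : l ∈ allLines u (.node a b)) : l.2 ≤ (treeM u (.node a b) - 1) - u := by
  have hK := allLines_K2 hu0 hu1 a b l h
  have hα := allLines_node_fst_ge hu0 hu1 a b l h
  nlinarith [mul_le_mul_of_nonneg_left hα hu0]

/-- (MONO) `0 < y ≤ x → G_t(y) ≤ G_t(x)`. -/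
theorem treeQf_sub_mono {u : ℚ} (hu : 0 < u) (hu1 : u ≤ 1) (t : SumTree) {y x : ℚ} (hy : 0 < y)
    (hyx : y ≤ x) : treeQf u t y - y ≤ treeQf u t x - x := by
  obtain ⟨l, hl, he⟩ := exists_allLine_eq_treeQf hu t y hy
  have hx := allLine_le_treeQf hu t l hl x (lt_of_lt_of_le hy hyx)
  obtain ⟨h0, -, -, -⟩ := allLines_bounds hu.le hu1 t l hl
  nlinarith [mul_le_mul_of_nonneg_left hyx h0]

/-- (SLOPE) at a node, `0 < y ≤ x → G(x) - G(y) ≤ (x - y)(μ - u)`. -/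
theorem treeQf_sub_slope {u : ℚ} (hu : 0 < u) (hu1 : u ≤ 1) (a b : SumTree) {y x : ℚ} (hy : 0 < y)
    (hyx : y ≤ x) :
    (treeQf u (.node a b) x - x) - (treeQf u (.node a b) y - y)
      ≤ (x - y) * ((treeM u (.node a b) - 1) - u) := by
  obtain ⟨l, hl, he⟩ := exists_allLine_eq_treeQf hu (.node a b) x (lt_of_lt_of_le hy hyx)
  have hy' := allLine_le_treeQf hu (.node a b) l hl y hy
  have hlam := allLines_node_snd_le hu.le hu1 a b l hl
  nlinarith [mul_le_mul_of_nonneg_left hlam (by linarith : (0:ℚ) ≤ x - y)]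

/-- (CONVEX) three-point convexity of `G_t` on `(0, ∞)`:
`0 < y₀ ≤ y₁ ≤ y₂ → (G(y₁) - G(y₀))(y₂ - y₁) ≤ (G(y₂) - G(y₁))(y₁ - y₀)`. -/
theorem treeQf_sub_convex {u : ℚ} (hu : 0 < u) (t : SumTree) {y0 y1 y2 : ℚ} (h0 : 0 < y0)
    (h01 : y0 ≤ y1) (h12 : y1 ≤ y2) :
    ((treeQf u t y1 - y1) - (treeQf u t y0 - y0)) * (y2 - y1)
      ≤ ((treeQf u t y2 - y2) - (treeQf u t y1 - y1)) * (y1 - y0) := by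
  have hy1 : 0 < y1 := lt_of_lt_of_le h0 h01
  obtain ⟨l, hl, he⟩ := exists_allLine_eq_treeQf hu t y1 hy1
  have g0 := allLine_le_treeQf hu t l hl y0 h0
  have g2 := allLine_le_treeQf hu t l hl y2 (lt_of_lt_of_le hy1 h12)
  -- G(y1) - G(y0) ≤ λ (y1 - y0) and λ (y2 - y1) ≤ G(y2) - G(y1)
  have e1 : (treeQf u t y1 - y1) - (treeQf u t y0 - y0) ≤ l.2 * (y1 - y0) := by nlinarith
  have e2 : l.2 * (y2 - y1) ≤ (treeQf u t y2 - y2) - (treeQf u t y1 - y1) := by nlinarith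
  nlinarith [mul_le_mul_of_nonneg_right e1 (by linarith : (0:ℚ) ≤ y2 - y1),
             mul_le_mul_of_nonneg_right e2 (by linarith : (0:ℚ) ≤ y1 - y0)]

/-- (K2-CHORD) at a node, `0 < y ≤ x`, `u x ≤ 1`:
`(G(x) - G(y))(1 - u x) ≤ (x - y)(μ - u + u² - u G(x))`. -/
theorem treeQf_K2chord {u : ℚ} (hu : 0 < u) (hu1 : u ≤ 1) (a b : SumTree) {y x : ℚ} (hy : 0 < y)
    (hyx : y ≤ x) (hux : u * x ≤ 1) :
    ((treeQf u (.node a b) x - x) - (treeQf u (.node a b) y - y)) * (1 - u * x)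
      ≤ (x - y) * ((treeM u (.node a b) - 1) - u + u * u - u * (treeQf u (.node a b) x - 1 - x)) := by
  have hx : 0 < x := lt_of_lt_of_le hy hyx
  obtain ⟨l, hl, he⟩ := exists_allLine_eq_treeQf hu (.node a b) x hx
  have gy := allLine_le_treeQf hu (.node a b) l hl y hy
  have hK := allLines_K2 hu.le hu1 a b l hl
  -- G(x) = α + λ x ;  G(x) - G(y) ≤ λ (x - y) ;  λ (1 - u x) ≤ μ - u + u² - u G(x)
  have e1 : (treeQf u (.node a b) x - x) - (treeQf u (.node a b) y - y) ≤ l.2 * (x - y) := by nlinarith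
  have e2 : l.2 * (1 - u * x) ≤ (treeM u (.node a b) - 1) - u + u * u
      - u * (treeQf u (.node a b) x - 1 - x) := by nlinarith
  nlinarith [mul_le_mul_of_nonneg_right e1 (by linarith : (0:ℚ) ≤ 1 - u * x),
             mul_le_mul_of_nonneg_right e2 (by linarith : (0:ℚ) ≤ x - y)]

/-- (D-CHORD) for every tree, `u² ≤ x ≤ y₂`, `0 < x`:
`(G(x) - μ)(y₂ - x) ≤ (x - u²)(G(y₂) - G(x))`. -/
theorem treeQf_Dchord {u : ℚ} (hu : 0 < u) (hu1 : u ≤ 1) (t : SumTree) {x y2 : ℚ} (hx : 0 < x)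
    (hux : u * u ≤ x) (hxy : x ≤ y2) :
    ((treeQf u t x - 1 - x) - (treeM u t - 1)) * (y2 - x)
      ≤ (x - u * u) * ((treeQf u t y2 - y2) - (treeQf u t x - x)) := by
  obtain ⟨l, hl, he⟩ := exists_allLine_eq_treeQf hu t x hx
  have g2 := allLine_le_treeQf hu t l hl y2 (lt_of_lt_of_le hx hxy)
  have hD := allLines_slope_le_deficit hu.le hu1 t l hl
  -- G(x) - μ = α + λ x - μ ≤ λ (x - u²) ;  λ (y2 - x) ≤ G(y2) - G(x)
  have e1 : (treeQf u t x - 1 - x) - (treeM u t - 1) ≤ l.2 * (x - u * u) := by nlinarith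
  have e2 : l.2 * (y2 - x) ≤ (treeQf u t y2 - y2) - (treeQf u t x - x) := by nlinarith
  nlinarith [mul_le_mul_of_nonneg_right e1 (by linarith : (0:ℚ) ≤ y2 - x),
             mul_le_mul_of_nonneg_right e2 (by linarith : (0:ℚ) ≤ x - u * u)]

/-- (CORNER ENVELOPE) at a node, `u² ≤ x`, `u x ≤ 1`, `0 < x`:
`(1 - u³) G(x) ≤ (x - u²)(μ - u + u²) + (1 - u x) μ`, i.e. `G(x) ≤ μ + (x - u²)(μ - u)/(1 + u + u²)`:
the value of the linear form `α + λ x` at the vertex K2 ∩ D of the line region. -/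
theorem treeQf_corner {u : ℚ} (hu : 0 < u) (hu1 : u ≤ 1) (a b : SumTree) {x : ℚ} (hx : 0 < x)
    (hux2 : u * u ≤ x) (hux : u * x ≤ 1) :
    (1 - u * u * u) * (treeQf u (.node a b) x - 1 - x)
      ≤ (x - u * u) * ((treeM u (.node a b) - 1) - u + u * u) + (1 - u * x) * (treeM u (.node a b) - 1) := by
  obtain ⟨l, hl, he⟩ := exists_allLine_eq_treeQf hu (.node a b) x hx
  have hK := allLines_K2 hu.le hu1 a b l hl
  have hD := allLines_slope_le_deficit hu.le hu1 (.node a b) l hl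
  -- (1 - u³)(α + λ x) = (x - u²)(u α + λ) + (1 - u x)(α + u² λ)
  have iden : (1 - u * u * u) * (l.1 + l.2 * x)
      = (x - u * u) * (u * l.1 + l.2) + (1 - u * x) * (l.1 + u * u * l.2) := by ring
  have hG : treeQf u (.node a b) x - 1 - x = l.1 + l.2 * x := by linarith
  rw [hG, iden]
  have e1 : (x - u * u) * (u * l.1 + l.2) ≤ (x - u * u) * ((treeM u (.node a b) - 1) - u + u * u) :=
    mul_le_mul_of_nonneg_left (by linarith) (by linarith)
  have e2 : (1 - u * x) * (l.1 + u * u * l.2) ≤ (1 - u * x) * (treeM u (.node a b) - 1) :=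
    mul_le_mul_of_nonneg_left (by linarith) (by linarith)
  linarith

end Summit.Ventures.CertifiedArithmetic.LowPrec.Opt
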